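import Literature.NumberTheory.Automorphic.TotallyRealModularity
import Literature.NumberTheory.Automorphic.BCDTModularityModPProofs
import Literature.NumberTheory.Automorphic.ReciprocityGLnPotentialModularityTateProofs
import HarnessLib

/-!
# "`ρ̄` is modular" over a totally real field (Freitas–Le Hung–Siksek 2015, §1): the residual
# counterpart of `IsHilbertModular`, with its first consequences proved

Topic `Literature/NumberTheory/Automorphic`.  One DEFINITION (a predicate with arguments, not a
named fact) and theorems; no `sorry`, no new named fact (D-0014 / D-0026).

## The printed notion

N. Freitas, B. V. Le Hung, S. Siksek, *Elliptic curves over real quadratic fields are modular*,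
Invent. Math. 201 (2015) 159–206 [FreitasLeHungSiksek2015], §1 (held text
`paper:arxiv-1310.7088`, p. 4 of the text), verbatim:

> "Let `p` be a rational prime. Denote by `ρ̄_{E,p} : G_K → Aut(E[p]) ≅ GL₂(𝔽_p)` the
> representation giving the action of `G_K` on the `p`-torsion of `E`.  We say `ρ̄_{E,p}` is
> modular if there exists a Hilbert cuspidal eigenform `𝔣` over `K` of parallel weight `2`, and a
> place `λ ∣ p` of `ℚ̄` such that `ρ̄^ss_{E,p} ∼ ρ̄^ss_{𝔣,λ}`."

This is hypothesis (i) of the modularity lifting theorem of the source (Thm. 2: "`ρ̄` is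
modular"), the conclusion of its Langlands–Tunnell step (Thm. 6: "`ρ̄_{E,3}` irreducible ⇒
`ρ̄_{E,3}` is modular") and the pivot of Wiles' `3–5` switch (§6: "Thus `ρ̄_{E,5} ∼ ρ̄_{E′,5}`
is modular").  The tree had the notion "`E` is modular" on the Borel–Jacquet data of
`AutomorphicRepsGL` (`IsAutomorphicOfWeightZero`, `IsHilbertModular`,
`TotallyRealModularity.lean`) and, over `ℚ`, "`ρ̄` is modular" through classical newforms
(`ModPGaloisRep.IsModular`, `BCDTModularity.lean`), but no carrier for "`ρ̄` is modular" over a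
totally real field; this file supplies it, so that Thms. 2 and 6 of the source (and the analogous
hypotheses of Thorne 2016, Kalyanswamy 2018, Box 2022, …) can be written as printed.

## Rendering (same dictionary as `TotallyRealModularity.lean`, "Rendering")

* "Hilbert cuspidal eigenform `𝔣` over `K` of parallel weight `2`" ↦ a cuspidal automorphic
  representation datum `π` of `GL₂(𝔸_K)` (`CuspidalAutomorphicRepData 2 K hK`) of weight zero
  (`HasWeightZero`), exactly as in `IsAutomorphicOfWeightZero` / `IsHilbertModular`; its Hecke
  eigenvalues enter only through the Hecke polynomials `X² - t_w X + s_w` of `π` at its unramified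
  places (`AutomorphicRepData.HasHeckePolynomialAt`; `t_w = θ_𝔣(T_w)`, `s_w = N(w) θ_𝔣(S_w)`).
* "`ρ̄^ss ∼ ρ̄^ss_{𝔣,λ}` for a place `λ ∣ p` of `ℚ̄`" ↦ the Frobenius form, which is how the
  relation is used and checked in print (Chebotarev density + Brauer–Nesbitt: two semisimple
  representations of `G_K` over a finite field with the same characteristic polynomials of
  Frobenius at almost all places are isomorphic; and `ρ̄_{𝔣,λ}(Frob_w)` has characteristic
  polynomial `X² - θ_𝔣(T_w) X + N(w) θ_𝔣(S_w) mod λ` at every `w ∤ p 𝔫` — Carayol, Taylor 1989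
  Thm. 1.1, Blasius–Rogawski, the normalisation of `ρ_{E,p} ≅ ρ_{𝔣,p}` in §1 of the source):
  there are a ring `O` of coefficients mapping injectively into `ℂ` (`ι : O →+* ℂ`; think of
  `O = ℤ[θ_𝔣(T_w), θ_𝔣(S_w) : w]`, a subring of the ring of integers of the Hecke field of `𝔣`)
  and a "reduction modulo `λ`" `red : O →+* k` such that, at all but finitely many finite places
  `w` of `K`, `π` has Hecke polynomial `X² - ι(t) X + ι(s)` for some `t, s ∈ O`, `ρ̄` is
  unramified at `w`, and every arithmetic Frobenius at `w` has characteristic polynomial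
  `X² - red(t) X + red(s)` on `ρ̄` (`FramedGaloisRep.IsUnramifiedAt`, `FramedGaloisRep.HasFrobCharpolyAt`,
  arithmetic Frobenius as everywhere in `GaloisRepresentations/` and in
  `IsTorsionGaloisRep.charpoly_eq_of_isArithFrobAt`).  Injectivity of `ι` ties `O` to the actual
  Hecke eigenvalues (without it `O = ℂ × k` would decouple the two conditions).  Given that the
  Hecke eigenvalues of `𝔣` are algebraic integers (Shimura; Taylor 1989, Thm. 1.1), a pair
  `(O, red)` as above yields a place `λ` of `ℚ̄` over `p` with `ρ̄^ss ∼ ρ̄^ss_{𝔣,λ}` (the kernel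
  of `red` on `ℤ[t_w, s_w : w] ⊆ ℤ̄` is a prime over `p = char k`; extend it to `ℤ̄` by
  lying-over) and conversely (restrict `λ` to `O = ℤ[t_w, s_w : w]`, whose image lies in the prime
  field generated by the traces and determinants of `ρ̄`); so the predicate is the printed one.
  The same convention (Hecke polynomial of `π` at `w` = characteristic polynomial of arithmetic
  Frobenius) is the one under which `IsAutomorphicOfWeightZero E` renders "`E` is modular"
  (`X² - a_w X + q_w` on both sides, Silverman C.21 Remark 21.3), which is what makes
  `WeierstrassCurve.IsTorsionGaloisRep.isHilbertModular` below a theorem.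
* Scope.  Stated for every number field `K` and every topological coefficient field `k` (it is
  FLS's notion for `K` totally real and `k` of characteristic `p`, e.g. `k = 𝔽_p` for `ρ̄_{E,p}`
  framed by `WeierstrassCurve.IsTorsionGaloisRep`); for `k` of characteristic `0` the predicate
  says that `ρ̄` itself is automorphic of weight zero in the Frobenius sense and is not used.

## What is proved

* `ModPGaloisRep.IsHilbertModular.conj` — independence of the frame (`ρ̄ ↦ P ρ̄ P⁻¹`);
  `WeierstrassCurve.IsTorsionGaloisRep.exists_conj_eq` — any two framed models of `E[n]` are
  conjugate (the change of basis is `ℤ/n`-linear); hence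
  `WeierstrassCurve.IsTorsionGaloisRep.isHilbertModular_of_isTorsionGaloisRep` — modularity of one
  framed model of `E[p]` is modularity of all of them ("`ρ̄_{E,p}` is modular" is well defined).
* `WeierstrassCurve.IsTorsionGaloisRep.isHilbertModular` — **the `p`-torsion of a modular
  elliptic curve is modular**: if the integral model `E / 𝓞 K` (`Δ(E) ≠ 0`) is automorphic of
  weight zero (`IsAutomorphicOfWeightZero E`) and `ρ̄ : Γ_K →ₜ* GL₂(𝔽_p)` frames the Galois action
  on `E[p]` (`(E ⊗ K).IsTorsionGaloisRep p ρ̄`), then `ρ̄` is modular.  This is the sentence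
  "Thus `ρ̄_{E,5} ∼ ρ̄_{E′,5}` is modular" of the proof of Thm. 3 of the source (§6) and the way
  hypothesis (i) of its Thm. 2 is met in every switching argument.  Proof: the `π` of `E`, the
  coefficient ring `O = ℤ` (`t = a_w(E)`, `s = q_w`) and `red : ℤ → 𝔽_p`; at the cofinitely many
  `w ∤ p Δ(E)` the curve has good reduction (`hasGoodReductionAt_baseChange_of_Δ_not_mem`), `E[p]`
  is unramified (`IsTorsionGaloisRep.isUnramifiedAt_of_hasGoodReductionAt`, Néron–Ogg–Shafarevich)
  and arithmetic Frobenius has characteristic polynomial `X² - ā_w X + q̄_w` on `E[p]`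
  (`IsTorsionGaloisRep.charpoly_eq_of_isArithFrobAt` with the discharged
  `trace/det_galoisRepTate_frobenius_of_hasGoodReductionAt_holds`, Silverman C.21.3 mod `p`),
  where `a_w` of Mathlib's minimal model is the `a_w = q_w + 1 - #E(k_w)` of the integral model
  (`frobeniusTraceAt_baseChange_eq_frobTraceAt`).  In particular, if one frame `ρ̄` frames both
  `E[p]` and `E′[p]` (an `𝔽_p[G_K]`-isomorphism `E[p] ≅ E′[p]`) and `E′` is modular, then
  `ρ̄ = ρ̄_{E,p}` is modular (apply the theorem to `E′`): the input of Thm. 2 in the `3–5` and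
  `3–7` switches.

## References

* [FreitasLeHungSiksek2015] N. Freitas, B. V. Le Hung, S. Siksek, Invent. Math. 201 (2015),
  §1 (definitions of "`E` is modular", "`ρ̄_{E,p}` is modular"; Thm. 2), §5 (Thm. 6), §6.
* [SilvermanAEC2009] J. H. Silverman, *The Arithmetic of Elliptic Curves*, 2nd ed., Prop. VII.4.1,
  C.21 Remark 21.3.
* R. Taylor, *On Galois representations associated to Hilbert modular forms*, Invent. Math. 98
  (1989), Thm. 1.1 (the normalisation `X² - θ(T_℘) X + N℘ θ(S_℘)`); cf.
  `HilbertModularGaloisRep.lean`.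
-/

noncomputable section

open scoped NumberField Polynomial MatrixGroups Matrix
open NumberField IsDedekindDomain Filter Polynomial

namespace Literature.NumberTheory.Automorphic

open GaloisRepresentations

/-! ## The definition -/

/-- **"`ρ̄` is modular"** for a two-dimensional mod-`p` Galois representation `ρ̄ : Γ_K →ₜ* GL₂(k)`
of a number field `K` (Freitas–Le Hung–Siksek 2015, §1: *"We say `ρ̄_{E,p}` is modular if there
exists a Hilbert cuspidal eigenform `𝔣` over `K` of parallel weight `2`, and a place `λ ∣ p` of
`ℚ̄` such that `ρ̄^ss_{E,p} ∼ ρ̄^ss_{𝔣,λ}`"*), rendered on the Borel–Jacquet data of the tree in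
the Frobenius form (module docstring, "Rendering"): there are `hK` (the compactness Prop typing
`π`), a cuspidal automorphic representation datum `π` of `GL₂(𝔸_K)` of weight zero (parallel
weight `2`), a coefficient ring `O` with an injective `ι : O →+* ℂ` and a reduction `red : O →+* k`
(the place `λ`), such that at all but finitely many finite places `w`, for some `t s : O`, `π`
has Hecke polynomial `X² - ι t X + ι s` at `w`, `ρ̄` is unramified at `w`, and every arithmetic
Frobenius at `w` has characteristic polynomial `X² - red t X + red s` on `ρ̄` — i.e.
`ρ̄^ss ∼ ρ̄^ss_{𝔣,λ}` by Chebotarev and Brauer–Nesbitt.  For `K` totally real and `k` of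
characteristic `p` this is the printed notion; see `WeierstrassCurve.IsTorsionGaloisRep.isHilbertModular`
for `ρ̄ = ρ̄_{E,p}` of a modular `E`.
[cite: FreitasLeHungSiksek2015, §1 (definition of "ρ̄_{E,p} is modular")] -/
def _root_.Literature.NumberTheory.GaloisRepresentations.ModPGaloisRep.IsHilbertModular
    {K : Type} [Field K] [NumberField K] {k : Type*} [Field k] [TopologicalSpace k]
    (ρ : ModPGaloisRep K k 2) : Prop :=
  ∃ (hK : isCompact_glFiniteIntegralLevel 2 K) (π : CuspidalAutomorphicRepData 2 K hK)
    (O : Type) (_ : CommRing O) (ι : O →+* ℂ) (red : O →+* k),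
    Function.Injective ι ∧ π.1.HasWeightZero ∧
      ∀ᶠ w : HeightOneSpectrum (𝓞 K) in cofinite, ∃ t s : O,
        π.1.HasHeckePolynomialAt w (X ^ 2 - C (ι t) * X + C (ι s)) ∧
          FramedGaloisRep.IsUnramifiedAt w ρ ∧
          FramedGaloisRep.HasFrobCharpolyAt w (X ^ 2 - C (red t) * X + C (red s)) ρ

/-! ## Independence of the frame -/

/-- "`ρ̄` is modular" does not depend on the frame: it is invariant under `ρ̄ ↦ P ρ̄ P⁻¹`
(`FramedRep.conj`), since unramifiedness (`FramedGaloisRep.isUnramifiedAt_conj_iff`) and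
characteristic polynomials (`Matrix.charpoly_units_conj`) are. [folklore] -/
theorem _root_.Literature.NumberTheory.GaloisRepresentations.ModPGaloisRep.IsHilbertModular.conj
    {K : Type} [Field K] [NumberField K] {k : Type*} [Field k] [TopologicalSpace k]
    [IsTopologicalRing k] {ρ : ModPGaloisRep K k 2} (h : ρ.IsHilbertModular) (P : GL (Fin 2) k) :
    ModPGaloisRep.IsHilbertModular (FramedRep.conj P ρ) := by
  obtain ⟨hK, π, O, _, ι, red, hι, h0, hw⟩ := h
  refine ⟨hK, π, O, inferInstance, ι, red, hι, h0, ?_⟩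
  filter_upwards [hw] with w hw
  obtain ⟨t, s, hH, hur, hF⟩ := hw
  refine ⟨t, s, hH, (FramedGaloisRep.isUnramifiedAt_conj_iff w P ρ).mpr hur, ?_⟩
  intro 𝔓 h𝔓 σ hσ
  rw [← hF 𝔓 h𝔓 σ hσ]
  simp only [FramedRep.charpoly, FramedRep.conj_apply, Units.val_mul, Matrix.coe_units_inv]
  exact Matrix.charpoly_units_conj P _

/-! ## Any two frames of `E[n]` are conjugate -/

/-- **Any two framed models of `E[n]` are conjugate.**  If `ρ̄` and `ρ̄′` both give the Galois
action on the `n`-torsion `E[n](F̄)` of a Weierstrass curve over a field `F` in some bases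
(`IsTorsionGaloisRep`: additive frames `e, e′ : E[n] ≃ (ℤ/n)²` with `e(σ • P) = ρ̄(σ) e(P)`), then
`ρ̄′ = P ρ̄ P⁻¹` for the change of frame `P = e′ ∘ e⁻¹ ∈ GL₂(ℤ/n)` (an additive, hence
`ℤ/n`-linear, automorphism of `(ℤ/n)²`, Mathlib `AddMonoidHom.toZModLinearMap` and
`LinearMap.toMatrix'`).  Cornell–Silverman–Stevens, Ch. II §7 ("`ρ̄_m : G → Aut(E[m]) ≅ GL₂(ℤ/mℤ)`,
well defined up to the choice of basis"); companion of the tree's `FLS2015.isTorsionGaloisRep_conj`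
(a conjugate of a frame is a frame).  Deliberate dot-notation extension of the tree's
`WeierstrassCurve.IsTorsionGaloisRep`. [cite: SilvermanCSS1997, §7] -/
theorem _root_.WeierstrassCurve.IsTorsionGaloisRep.exists_conj_eq {F : Type*} [Field F]
    {W : WeierstrassCurve F} {n : ℕ} {ρ ρ' : FramedGaloisRep F (ZMod n) 2}
    (h : W.IsTorsionGaloisRep n ρ) (h' : W.IsTorsionGaloisRep n ρ') :
    ∃ P : GL (Fin 2) (ZMod n), ρ' = FramedRep.conj P ρ := by
  obtain ⟨e, he⟩ := h
  obtain ⟨e', he'⟩ := h'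
  -- the change of frame `φ = e′ ∘ e⁻¹`, an additive hence `ℤ/n`-linear automorphism of `(ℤ/n)²`
  let φ : (Fin 2 → ZMod n) ≃+ (Fin 2 → ZMod n) := e.symm.trans e'
  let L : (Fin 2 → ZMod n) →ₗ[ZMod n] (Fin 2 → ZMod n) := φ.toAddMonoidHom.toZModLinearMap n
  let L' : (Fin 2 → ZMod n) →ₗ[ZMod n] (Fin 2 → ZMod n) :=
    φ.symm.toAddMonoidHom.toZModLinearMap n
  have hLL' : L.comp L' = LinearMap.id := LinearMap.ext fun x => φ.apply_symm_apply x
  have hL'L : L'.comp L = LinearMap.id := LinearMap.ext fun x => φ.symm_apply_apply x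
  let P : GL (Fin 2) (ZMod n) :=
    ⟨LinearMap.toMatrix' L, LinearMap.toMatrix' L',
      by rw [← LinearMap.toMatrix'_comp, hLL', LinearMap.toMatrix'_id],
      by rw [← LinearMap.toMatrix'_comp, hL'L, LinearMap.toMatrix'_id]⟩
  have hP : ∀ x : Fin 2 → ZMod n, (P : Matrix (Fin 2) (Fin 2) (ZMod n)) *ᵥ x = e' (e.symm x) :=
    fun x => LinearMap.toMatrix'_mulVec L x
  refine ⟨P, ContinuousMonoidHom.ext fun σ => ?_⟩
  -- both sides act in the same way on `x = e Q`
  have key : ∀ x : Fin 2 → ZMod n,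
      (P : Matrix (Fin 2) (Fin 2) (ZMod n)) *ᵥ
          (((ρ σ : GL (Fin 2) (ZMod n)) : Matrix (Fin 2) (Fin 2) (ZMod n)) *ᵥ x) =
        ((ρ' σ : GL (Fin 2) (ZMod n)) : Matrix (Fin 2) (Fin 2) (ZMod n)) *ᵥ
          ((P : Matrix (Fin 2) (Fin 2) (ZMod n)) *ᵥ x) := fun x => by
    obtain ⟨Q, rfl⟩ := e.surjective x
    rw [hP, hP, ← he σ Q, e.symm_apply_apply, e.symm_apply_apply, he' σ Q]
  have hmat : (P : Matrix (Fin 2) (Fin 2) (ZMod n)) *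
        ((ρ σ : GL (Fin 2) (ZMod n)) : Matrix (Fin 2) (Fin 2) (ZMod n)) =
      ((ρ' σ : GL (Fin 2) (ZMod n)) : Matrix (Fin 2) (Fin 2) (ZMod n)) *
        (P : Matrix (Fin 2) (Fin 2) (ZMod n)) := by
    refine Matrix.toLin'.injective (LinearMap.ext fun x => ?_)
    rw [Matrix.toLin'_apply, Matrix.toLin'_apply, ← Matrix.mulVec_mulVec, ← Matrix.mulVec_mulVec,
      key]
  have hGL : P * ρ σ = ρ' σ * P := Units.ext (by rw [Units.val_mul, Units.val_mul]; exact hmat)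
  rw [FramedRep.conj_apply, hGL, mul_inv_cancel_right]

/-- "`ρ̄` is modular" is a property of the Galois module `E[p]`, not of the frame: if one framed
model of `E[p]` is modular, all are (`IsTorsionGaloisRep.exists_conj_eq` and
`ModPGaloisRep.IsHilbertModular.conj`). [folklore] -/
theorem _root_.WeierstrassCurve.IsTorsionGaloisRep.isHilbertModular_of_isTorsionGaloisRep
    {K : Type} [Field K] [NumberField K] {W : WeierstrassCurve K} {p : ℕ} [Fact p.Prime]
    {ρ ρ' : ModPGaloisRep K (ZMod p) 2} (hρ' : W.IsTorsionGaloisRep p ρ')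
    (hρ : W.IsTorsionGaloisRep p ρ) (h : ρ.IsHilbertModular) : ρ'.IsHilbertModular := by
  obtain ⟨P, rfl⟩ := hρ.exists_conj_eq hρ'
  exact h.conj P

/-! ## The `p`-torsion of a modular elliptic curve is modular -/

/-- **The mod-`p` representation of a modular elliptic curve is modular** (the sentence "Thus
`ρ̄_{E,5} ∼ ρ̄_{E′,5}` is modular" of Freitas–Le Hung–Siksek 2015, §6, and the way hypothesis (i)
of their Thm. 2 is met): for an integral model `E / 𝓞 K` with `Δ(E) ≠ 0` which is automorphic of
weight zero (`IsAutomorphicOfWeightZero E`: a weight-zero cuspidal `π` with Hecke polynomial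
`X² - a_w X + q_w` at every `w ∤ Δ(E)`), a prime `p` and a frame `ρ̄ : Γ_K →ₜ* GL₂(𝔽_p)` of the
Galois action on `E[p]` (`IsTorsionGaloisRep`), `ρ̄` is modular: witnesses `π`, `O = ℤ`,
`red : ℤ → 𝔽_p`, `t = a_w(E)`, `s = q_w`; at the cofinitely many `w ∤ p Δ(E)`
(`eventually_not_mem_asIdeal`, `eventually_natCast_not_mem_asIdeal`) the curve `E ⊗ K` has good
reduction (`hasGoodReductionAt_baseChange_of_Δ_not_mem`), so `E[p]` is unramified at `w`
(`IsTorsionGaloisRep.isUnramifiedAt_of_hasGoodReductionAt`, Silverman VII.4.1) and arithmetic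
Frobenius has characteristic polynomial `X² - ā_w X + q̄_w` on it
(`IsTorsionGaloisRep.charpoly_eq_of_isArithFrobAt` with
`trace/det_galoisRepTate_frobenius_of_hasGoodReductionAt_holds`, Silverman C.21 Remark 21.3), and
`a_w` read off Mathlib's minimal model is `a_w = q_w + 1 - #E(k_w)` of the given model
(`frobeniusTraceAt_baseChange_eq_frobTraceAt`, `natCard_residueField_eq_residueCard`).
Deliberate dot-notation extension of the tree's `WeierstrassCurve.IsTorsionGaloisRep`.
[cite: FreitasLeHungSiksek2015, §6 (proof of Thm. 3 for p = 5) and §1]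
[cite: SilvermanAEC2009, Prop. VII.4.1 and C.21 Remark 21.3] -/
theorem _root_.WeierstrassCurve.IsTorsionGaloisRep.isHilbertModular {K : Type} [Field K]
    [NumberField K] {E : WeierstrassCurve (𝓞 K)} {p : ℕ} [Fact p.Prime]
    {ρ : ModPGaloisRep K (ZMod p) 2} (hρ : (E.baseChange K).IsTorsionGaloisRep p ρ)
    (hΔ : E.Δ ≠ 0) (hE : IsAutomorphicOfWeightZero E) : ρ.IsHilbertModular := by
  obtain ⟨hK, π, h0, hH⟩ := hE
  refine ⟨hK, π, ℤ, inferInstance, Int.castRingHom ℂ, Int.castRingHom (ZMod p),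
    Int.cast_injective, h0, ?_⟩
  filter_upwards [eventually_not_mem_asIdeal hΔ,
    eventually_natCast_not_mem_asIdeal K (Fact.out : p.Prime).ne_zero] with w hwΔ hwp
  have hgood : (E.baseChange K).HasGoodReductionAt w := hasGoodReductionAt_baseChange_of_Δ_not_mem hwΔ
  haveI : (E.baseChange K).IsElliptic := hgood.isElliptic
  refine ⟨frobTraceAt E w, (w.residueCard : ℤ), ?_, ?_, ?_⟩
  · -- the Hecke polynomial `X² - a_w X + q_w` of `π` at `w ∤ Δ(E)`
    have h := hH w hwΔ
    simp only [frobPoly, Polynomial.map_sub, Polynomial.map_add, Polynomial.map_mul,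
      Polynomial.map_pow, Polynomial.map_X, Polynomial.map_C] at h
    exact h
  · -- `E[p]` is unramified at the good place `w ∤ p`
    exact hρ.isUnramifiedAt_of_hasGoodReductionAt hgood hwp
  · -- arithmetic Frobenius on `E[p]`: `X² - ā_w X + q̄_w`
    intro 𝔓 h𝔓 σ hσ
    have h := hρ.charpoly_eq_of_isArithFrobAt
      ((E.baseChange K).trace_galoisRepTate_frobenius_of_hasGoodReductionAt_holds p)
      ((E.baseChange K).det_galoisRepTate_frobenius_of_hasGoodReductionAt_holds p) hwp hgood h𝔓 hσ
    rw [frobeniusTraceAt_baseChange_eq_frobTraceAt hwΔ,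
      WeierstrassCurve.natCard_residueField_eq_residueCard] at h
    rw [FramedRep.charpoly, h, eq_intCast, eq_intCast, Int.cast_natCast]

end Literature.NumberTheory.Automorphic

end
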